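import Summits.QuantumFields.BalabanUV.T4Continuum.Support.B13TermHistSecant
import Summits.QuantumFields.BalabanUV.T4Continuum.Support.B13TermHistEnvelope
import Summits.QuantumFields.BalabanUV.T4Continuum.Support.B13ActMajorantLevels
import Summits.QuantumFields.BalabanUV.T4Continuum.Support.UrsellTermBudgetLevels

/-!
# NE5 ∕ U3 — O2-hist, secant face: the FIRST-MOMENT budget of `B13TermHistSecant.histSecant_b13_of_act` IN THE PRINTED
# LEVELWISE FORM for the labels indexing of record (`B13StepTermSocket.labelsIndexing`, leaf-02), under a UNIFORM exponent bound:
# `Σ'ᵢ secMajorant N A k X i ≤ N̄ · Σ' n, (n+1)·levelMajorant A k X n` — so that a per-level bound of the (2.39)–(2.41) ∕ [Dimock2013]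
# App. B step 4 kind with one extra factor `(n+1)` closes `HistSecant` for every model built on the socket

Cell `pub-balaban`, unit `b2b-balaban-t4-ne5-formalise-leaf-03` (NE5 formalisation swarm, LEAF PROVER 03, gen 2; companion of
`Support/B13TermHistSecant.lean`, O2-hist INTENT `CLAIMS.log` l.6438).  Summits-side bookkeeping under the LEAN PLACEMENT RULE (NOT a
Literature module).  HONEST FRAMING: rung (B)+1 of the FINITE-VOLUME T⁴ programme — NOT infinite volume, NOT a mass gap, NOT the Clay
problem, NOT NE5 (NOT PRINTED; GAPS G-t4-U3-1).  HONEST DEPENDENCY (cell line, verbatim): continuum YM on T⁴ ⇐ BetaPertH ∧ nine spine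
estimates (0/9 proved); BetaPertH ⇐ (D1) ∧ (D4) ∧ CAP+tail; G-an2-4 gates asym, D1 and NE2/3/4.

WHAT THIS FILE DOES.  `B13TermHistSecant.histSecant_b13_of_act` reduces the reach-free history modulus `HistSecant` of the Ursell
term family to per-activity data (structure, exponent bounds `N`, absolute majorants `A`) plus two per-domain series binders over
the abstract term index: d3's `Summable (actMajorant A k X)` and the FIRST-MOMENT budget of `secMajorant N A k X i =
(Σ_m N_m)·actMajorant A k X i`.  Leaf-04's `B13ActMajorantLevels` (p208829) rewrote the former, for the indexing of record
`labelsIndexing G D` ∕ `touchInc G`, in the printed LEVELWISE form `levelMajorant G D A k X n = Σ_{(Z₀,…,Zₙ)} |ρᵀ(Z)|∕(n+1)!·Π_m w(Z_m)`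
([Balaban1988RG2Cluster] p. 20 ∕ (2.39)–(2.41) p. 21, [Dimock2013] App. B step 4: a bound per number of factors, then the sum over
`n` — locators only).  Here, under a UNIFORM exponent bound `N ≤ N̄` (the tree's `T4InputCauchyRateSecant.moment_of_uniform`
currency: *the secant currency is never worse than `N̄` times the majorant budget*), the secant majorant at level `n` is at most
`(n+1)·N̄` times the combinatorial majorant (one marked factor out of `n+1`), so:
* §1 `secMajorant_le_of_uniform`: `secMajorant N A k X ⟨n, t⟩ ≤ ((n+1)·N̄)·actMajorant A k X ⟨n, t⟩`;
* §2 `summable_secMajorant_of_levelwise` ∕ `tsum_secMajorant_le_of_levelwise`: from `Summable (fun n ↦ (n+1)·levelMajorant G D A k X n)`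
  the secant majorant is summable on the term index and `Σ'ᵢ secMajorant … i ≤ N̄·Σ' n, (n+1)·levelMajorant … n`
  (`summable_sigma_of_nonneg`, `Summable.tsum_sigma'`, leaf-04's level slices BY NAME); `summable_levelMajorant_of_moment`
  (the plain level series is dominated by the weighted one);
* §3 the payoff for ANY step model on the socket (`M.Out = out (labelsIndexing G D) (touchInc G) act`):
  **`histSecant_socket_of_levelMoment`** — structure `ActExpLinearOn`, exponent bounds `ActExpNormBound … M.rHist N` with
  `0 ≤ N ≤ N̄`, absolute majorants `ActAbsBound … A` with `A ≥ 0`, and the LEVELWISE WEIGHTED BUDGET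
  `Summable (fun n ↦ (n+1)·levelMajorant G D (A k g U) k X n) ∧ Σ' n, (n+1)·levelMajorant … n ≤ G₁′·e^{−κd(X)}` per step-`k` domain
  ⟹ `HistSecant M K W κ (2·(N̄·G₁′))`;
* §4 for completeness the CAUCHY face on the socket from leaf-04's levelwise binders: `histFibreEnvelopeCl_socket_of_levelBudget`
  (`BoxInClass` ∧ activity norm majorant ∧ `Summable (levelMajorant …) ∧ Σ' n levelMajorant … ≤ G′·e^{−κd(X)}` ∧ `ActExpLinearOn` ⟹
  `HistFibreEnvelopeCl M W κ G′` — `B13TermHistEnvelope.histFibreEnvelopeCl_b13_of_actBound` with `summable_actMajorant_of_levelwise` ∕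
  `tsum_actMajorant_le_of_levelwise` BY NAME).
* §5 the weighted level budget DISCHARGED, at decay rate `κ = 0`, from leaf-08's anchored exponential activity norm (`UrsellTermBudget`∕`UrsellTermBudgetLevels`
  p209547∕p209760: footprint-local reach `ν`, `Σ_{Z ∋ q} actSum(Z)·e^{#cubes Z} ≤ Φ`, `4νΦ < 1` — binder (i)'s norm, displayed): leaf-08's `UrsellTermBudget.levelMajorant_le` (module `UrsellTermBudgetLevels`) p209760 BY NAME
  (`levelMajorant … n ≤ Φ·(4νΦ)^n`), `weighted_level_budget_of_actNorm`
  (`Σ' n (n+1)·levelMajorant … n ≤ Φ∕(1 − 4νΦ)²` — the arithmetico-geometric series), and the payoff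
  **`histSecant_socket_of_actNorm : … → HistSecant M K W 0 (2·(N̄·Φ∕(1 − 4νΦ)²))`** — the secant twin of leaf-08's
  `classBound_b13_of_actNorm`: on the socket, the history half of W2 is reduced to the per-activity structure, exponent bounds
  `0 ≤ N ≤ N̄` and ABSOLUTE activity majorants `A` with anchored exponential norm `Φ` — nothing else.
What remains displayed (before §5) is thus LITERALLY a per-`n` estimate of `(n+1)·Σ_{(Z₀,…,Zₙ): ∪Z_m = X} |ρᵀ|∕(n+1)!·Π w(Z_m)` summed over `n`
(the tree-graph summation — leaf-08's `UrsellTreeSum` p208810 and the template lineage's `Dimock2011to13/TreeGraphSummation` p209323,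
consumers in progress; the extra `(n+1)` is absorbed by any geometric room in `n`; NOT claimed here), the uniform exponent bound `N̄` ((2.18)∕(2.20) KIND; for route P2's term
data `B13TermHistSecant.actExpNormBound_of_readUnitBound`) and the absolute activity majorants ((2.15)∕(2.38) KIND).  Nothing of the
manuscripts under audit is asserted.  0 sorry; no new axioms.
-/

noncomputable section

open scoped BigOperators

namespace Summit.QuantumFields.BalabanUV.T4Continuum.B13TermHistSecantLevels

open Literature.MathematicalPhysics.QuantumFieldTheory.Balaban1983to89.T4OutputRate (Carriers)
open Literature.MathematicalPhysics.QuantumFieldTheory.Balaban1983to89.T4InputCauchyRateData (StepModel)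
open Literature.MathematicalPhysics.QuantumFieldTheory.Balaban1983to89.T4InputCauchyRateSecant (HistSecant)
open Summit.QuantumFields.BalabanUV.T4Continuum.ClusterRepOfDomains (DomainGeometry)
open Summit.QuantumFields.BalabanUV.T4Continuum.B13StepTermLabels (InnerLabel PolyLabel TermIdx InnerData termLabels)
open Summit.QuantumFields.BalabanUV.T4Continuum.B13StepTermFamily (ActData ActExpLinearOn term out)
open Summit.QuantumFields.BalabanUV.T4Continuum.B13StepTermSocket (labelsIndexing touchInc)
open Summit.QuantumFields.BalabanUV.T4Continuum.B13TermRep (actMajorant actMajorant_nonneg)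
open Literature.MathematicalPhysics.QuantumFieldTheory.Balaban1983to89.T4InputCauchyRateSpecies (BoxInClass)
open Literature.MathematicalPhysics.QuantumFieldTheory.Balaban1983to89.T4InputCauchyRateTermwise (HistFibreEnvelopeCl)
open Summit.QuantumFields.BalabanUV.T4Continuum.B13ActMajorantLevels
  (levelMajorant levelMajorant_nonneg sum_actMajorant_termLabels actMajorant_eq_zero_of_not_mem summable_actMajorant_of_levelwise
    tsum_actMajorant_le_of_levelwise)
open Summit.QuantumFields.BalabanUV.T4Continuum.B13TermHistEnvelope (histFibreEnvelopeCl_b13_of_actBound)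
open Summit.QuantumFields.BalabanUV.T4Continuum.UrsellTreeSum (ind)
open Summit.QuantumFields.BalabanUV.T4Continuum.B13ActMajorantLevels (polyWeight)
open Summit.QuantumFields.BalabanUV.T4Continuum.B13TermHistSecant
  (ActExpNormBound ActAbsBound secMajorant secMajorant_nonneg histSecant_b13_of_act)

variable {C : Carriers} [DecidableEq C.Dom] {Cube : Type*} [DecidableEq Cube] {Bnd : Type*} [DecidableEq Bnd]
  {G : DomainGeometry C Cube} {D : InnerData C Bnd}

/-! ## §1 One marked factor out of `n + 1`: the secant majorant under a uniform exponent bound -/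

/-- [folklore] **UNIFORM EXPONENT BOUND ⟹ `secMajorant ≤ (n+1)·N̄·actMajorant` AT LEVEL `n`**: the sum of the `n + 1` factors'
exponent bounds is at most `(n+1)·N̄`, and the combinatorial majorant is nonnegative. -/
theorem secMajorant_le_of_uniform {N A : C.Dom → InnerLabel C.Dom Bnd → ℝ} {Nbar : ℝ} (hN : ∀ Z ℓ, N Z ℓ ≤ Nbar)
    (hA : ∀ Z ℓ, 0 ≤ A Z ℓ) (k : ℕ) (X : C.Dom) (n : ℕ) (t : Fin (n + 1) → PolyLabel C.Dom Bnd) :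
    secMajorant (labelsIndexing G D) (touchInc G) N A k X ⟨n, t⟩ ≤
      ((n : ℝ) + 1) * Nbar * actMajorant (labelsIndexing G D) (touchInc G) A k X ⟨n, t⟩ := by
  unfold secMajorant
  refine mul_le_mul_of_nonneg_right ?_ (actMajorant_nonneg hA k X _)
  calc ∑ m, N ((labelsIndexing G D).poly ⟨n, t⟩ m) ((labelsIndexing G D).lab ⟨n, t⟩ m)
      ≤ ∑ _m : Fin (n + 1), Nbar := Finset.sum_le_sum fun m _ => hN _ _
    _ = ((n : ℝ) + 1) * Nbar := by simp

/-! ## §2 Summability and the `tsum` of the secant majorant from the `(n+1)`-weighted level majorants -/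

/-- [folklore] Off the level-`n` catalogue at `X` the secant majorant vanishes. -/
theorem secMajorant_eq_zero_of_not_mem (N A : C.Dom → InnerLabel C.Dom Bnd → ℝ) {k : ℕ} {X : C.Dom} {n : ℕ}
    {t : Fin (n + 1) → PolyLabel C.Dom Bnd} (ht : t ∉ termLabels G D k X n) :
    secMajorant (labelsIndexing G D) (touchInc G) N A k X ⟨n, t⟩ = 0 := by
  rw [secMajorant, actMajorant_eq_zero_of_not_mem A ht, mul_zero]

/-- [folklore] The level-`n` slice of the secant majorant is at most `(n+1)·N̄` times the level majorant. -/
theorem sum_secMajorant_termLabels_le {N A : C.Dom → InnerLabel C.Dom Bnd → ℝ} {Nbar : ℝ} (hN : ∀ Z ℓ, N Z ℓ ≤ Nbar)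
    (hA : ∀ Z ℓ, 0 ≤ A Z ℓ) {k : ℕ} {X : C.Dom} (hX : C.scale X = k) (n : ℕ) :
    ∑ t ∈ termLabels G D k X n, secMajorant (labelsIndexing G D) (touchInc G) N A k X ⟨n, t⟩ ≤
      Nbar * (((n : ℝ) + 1) * levelMajorant G D A k X n) := by
  calc ∑ t ∈ termLabels G D k X n, secMajorant (labelsIndexing G D) (touchInc G) N A k X ⟨n, t⟩
      ≤ ∑ t ∈ termLabels G D k X n, ((n : ℝ) + 1) * Nbar * actMajorant (labelsIndexing G D) (touchInc G) A k X ⟨n, t⟩ :=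
        Finset.sum_le_sum fun t _ => secMajorant_le_of_uniform hN hA k X n t
    _ = Nbar * (((n : ℝ) + 1) * levelMajorant G D A k X n) := by
        rw [← Finset.mul_sum, sum_actMajorant_termLabels A hX n]; ring

/-- [folklore] **SUMMABILITY FROM THE WEIGHTED LEVELS**: for `0 ≤ N ≤ N̄` and `A ≥ 0`, if `(n+1)·levelMajorant G D A k X n` is summable
in `n` at the step-`k` domain `X`, then `secMajorant … N A k X` is summable on the term index (`summable_sigma_of_nonneg`: every level
is a finite sum, dominated by `N̄·(n+1)·levelMajorant n`). -/
theorem summable_secMajorant_of_levelwise {N A : C.Dom → InnerLabel C.Dom Bnd → ℝ} {Nbar : ℝ} (hN0 : ∀ Z ℓ, 0 ≤ N Z ℓ)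
    (hN : ∀ Z ℓ, N Z ℓ ≤ Nbar) (hA : ∀ Z ℓ, 0 ≤ A Z ℓ) {k : ℕ} {X : C.Dom} (hX : C.scale X = k)
    (hlev : Summable fun n : ℕ => ((n : ℝ) + 1) * levelMajorant G D A k X n) :
    Summable (secMajorant (labelsIndexing G D) (touchInc G) N A k X) := by
  have hnn : ∀ i, 0 ≤ secMajorant (labelsIndexing G D) (touchInc G) N A k X i := secMajorant_nonneg hN0 hA k X
  refine (summable_sigma_of_nonneg hnn).2 ⟨fun n => ?_, ?_⟩
  · exact summable_of_ne_finset_zero (s := termLabels G D k X n) fun t ht => secMajorant_eq_zero_of_not_mem N A ht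
  · have hle : ∀ n, ∑' t : Fin (n + 1) → PolyLabel C.Dom Bnd, secMajorant (labelsIndexing G D) (touchInc G) N A k X ⟨n, t⟩ ≤
        Nbar * (((n : ℝ) + 1) * levelMajorant G D A k X n) := fun n => by
      rw [tsum_eq_sum (s := termLabels G D k X n) fun t ht => secMajorant_eq_zero_of_not_mem N A ht]
      exact sum_secMajorant_termLabels_le hN hA hX n
    refine Summable.of_nonneg_of_le (fun n => tsum_nonneg fun t => hnn _) hle (hlev.mul_left Nbar)

/-- [folklore] **THE `tsum` BY WEIGHTED LEVELS**: under the same hypotheses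
`Σ'ᵢ secMajorant … N A k X i ≤ N̄·Σ' n, (n+1)·levelMajorant G D A k X n` (`Summable.tsum_sigma'`, level slices bounded as above). -/
theorem tsum_secMajorant_le_of_levelwise {N A : C.Dom → InnerLabel C.Dom Bnd → ℝ} {Nbar : ℝ} (hN0 : ∀ Z ℓ, 0 ≤ N Z ℓ)
    (hN : ∀ Z ℓ, N Z ℓ ≤ Nbar) (hA : ∀ Z ℓ, 0 ≤ A Z ℓ) {k : ℕ} {X : C.Dom} (hX : C.scale X = k)
    (hlev : Summable fun n : ℕ => ((n : ℝ) + 1) * levelMajorant G D A k X n) :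
    ∑' i, secMajorant (labelsIndexing G D) (touchInc G) N A k X i ≤ Nbar * ∑' n : ℕ, ((n : ℝ) + 1) * levelMajorant G D A k X n := by
  have hs := summable_secMajorant_of_levelwise hN0 hN hA hX hlev
  have hlevel : ∀ n, Summable fun t : Fin (n + 1) → PolyLabel C.Dom Bnd =>
      secMajorant (labelsIndexing G D) (touchInc G) N A k X ⟨n, t⟩ :=
    fun n => summable_of_ne_finset_zero (s := termLabels G D k X n) fun t ht => secMajorant_eq_zero_of_not_mem N A ht
  rw [hs.tsum_sigma' hlevel, ← tsum_mul_left]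
  refine (hs.sigma' hlevel).tsum_le_tsum (fun n => ?_) (hlev.mul_left Nbar)
  rw [tsum_eq_sum (s := termLabels G D k X n) fun t ht => secMajorant_eq_zero_of_not_mem N A ht]
  exact sum_secMajorant_termLabels_le hN hA hX n

/-- [folklore] The plain level series is dominated by the weighted one (`levelMajorant ≤ (n+1)·levelMajorant`, both nonnegative). -/
theorem summable_levelMajorant_of_moment {A : C.Dom → InnerLabel C.Dom Bnd → ℝ} (hA : ∀ Z ℓ, 0 ≤ A Z ℓ) {k : ℕ} {X : C.Dom}
    (hlev : Summable fun n : ℕ => ((n : ℝ) + 1) * levelMajorant G D A k X n) : Summable (levelMajorant G D A k X) :=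
  Summable.of_nonneg_of_le (levelMajorant_nonneg hA k X) (fun n =>
    le_mul_of_one_le_left (levelMajorant_nonneg hA k X n) (by linarith [(Nat.cast_nonneg n : (0 : ℝ) ≤ n)])) hlev

/-! ## §3 The payoff: `HistSecant` for models on the socket from per-activity data and the weighted level budget -/

section Payoff

variable {Op Hist Ω : Type*} [NormedAddCommGroup Op] [NormedSpace ℂ Op] [NormedAddCommGroup Hist] [NormedSpace ℂ Hist]
  [MeasurableSpace Ω] {act : C.Dom → InnerLabel C.Dom Bnd → Op → Hist → ℂ} {Dt : ActData C.Dom (InnerLabel C.Dom Bnd) Op Hist Ω}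

/-- [folklore] **`HistSecant` ON THE SOCKET FROM LEVELWISE BINDERS.**  For a step model with `M.Out = out (labelsIndexing G D)
(touchInc G) act`: leaf-08's STRUCTURE `ActExpLinearOn`; per-activity exponent bounds `ActExpNormBound … M.rHist N` with
`0 ≤ N ≤ N̄`, `0 ≤ N̄` ((2.18)∕(2.20) KIND; displayed); ABSOLUTE activity majorants `ActAbsBound … A` with `A ≥ 0` ((2.15)∕(2.38) KIND;
displayed); and at every step-`k` domain the WEIGHTED LEVEL BUDGET `Summable (fun n ↦ (n+1)·levelMajorant G D (A k g U) k X n) ∧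
Σ' n, (n+1)·levelMajorant … n ≤ G₁′·e^{−κd(X)}` ((2.39)–(2.41) ∕ App. B step 4 KIND with one marked factor; displayed) ⟹
`HistSecant M K W κ (2·(N̄·G₁′))` — no reach, no slack, no room, no analyticity hypothesis. -/
theorem histSecant_socket_of_levelMoment {M : StepModel C Op Hist}
    (hM : ∀ k o h X, M.Out k o h X = out (labelsIndexing G D) (touchInc G) act k o h X)
    {K : ℕ → (ℕ → ℝ) → C.BgB → Set (Op × Hist)} {W : Set (ℕ → ℝ)}
    {N A : ℕ → (ℕ → ℝ) → C.BgB → C.Dom → InnerLabel C.Dom Bnd → ℝ} {Nbar κ G₁' : ℝ}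
    (hexp : ActExpLinearOn (labelsIndexing G D) act Dt K W) (hN : ActExpNormBound (labelsIndexing G D) Dt K W M.rHist N)
    (hN0 : ∀ k g U Z ℓ, 0 ≤ N k g U Z ℓ) (hNle : ∀ k g U Z ℓ, N k g U Z ℓ ≤ Nbar) (hNbar : 0 ≤ Nbar)
    (habs : ActAbsBound (labelsIndexing G D) Dt K W A) (hA0 : ∀ k g U Z ℓ, 0 ≤ A k g U Z ℓ)
    (hbud : ∀ k, ∀ g ∈ W, ∀ (U : C.BgB) (X : C.Dom), C.scale X = k →
      Summable (fun n : ℕ => ((n : ℝ) + 1) * levelMajorant G D (A k g U) k X n) ∧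
        ∑' n : ℕ, ((n : ℝ) + 1) * levelMajorant G D (A k g U) k X n ≤ G₁' * Real.exp (-(κ * C.d X))) :
    HistSecant M K W κ (2 * (Nbar * G₁')) := by
  refine histSecant_b13_of_act (inc := touchInc G) hM hexp hN habs hN0 (fun k g hg U X hX => ?_) fun k g hg U X hX => ?_
  · exact summable_actMajorant_of_levelwise (hA0 k g U) hX (summable_levelMajorant_of_moment (hA0 k g U) (hbud k g hg U X hX).1)
  · obtain ⟨hs, hle⟩ := hbud k g hg U X hX
    refine ⟨summable_secMajorant_of_levelwise (hN0 k g U) (hNle k g U) (hA0 k g U) hX hs, ?_⟩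
    calc ∑' i, secMajorant (labelsIndexing G D) (touchInc G) (N k g U) (A k g U) k X i
        ≤ Nbar * ∑' n : ℕ, ((n : ℝ) + 1) * levelMajorant G D (A k g U) k X n :=
          tsum_secMajorant_le_of_levelwise (hN0 k g U) (hNle k g U) (hA0 k g U) hX hs
      _ ≤ Nbar * (G₁' * Real.exp (-(κ * C.d X))) := mul_le_mul_of_nonneg_left hle hNbar
      _ = Nbar * G₁' * Real.exp (-(κ * C.d X)) := by ring

/-! ## §4 For completeness: the Cauchy face on the socket from leaf-04's levelwise binders -/

/-- [folklore] **`HistFibreEnvelopeCl` ON THE SOCKET FROM LEVELWISE BINDERS**: slack `BoxInClass M K W`, a nonnegative activity norm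
majorant `‖act Z ℓ q.1 q.2‖ ≤ A k g U Z ℓ` on the factors of the tuples localizing at a step-`k` domain ((2.38) KIND; displayed), the
levelwise budget `Summable (levelMajorant G D (A k g U) k X) ∧ Σ' n, levelMajorant … n ≤ G′·e^{−κd(X)}` ((2.39)–(2.41) KIND; displayed)
and the structure `ActExpLinearOn` ⟹ `HistFibreEnvelopeCl M W κ G′` (the companion file's per-domain Cauchy face with leaf-04's
`summable_actMajorant_of_levelwise` ∕ `tsum_actMajorant_le_of_levelwise`). -/
theorem histFibreEnvelopeCl_socket_of_levelBudget {M : StepModel C Op Hist}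
    (hM : ∀ k o h X, M.Out k o h X = out (labelsIndexing G D) (touchInc G) act k o h X)
    {K : ℕ → (ℕ → ℝ) → C.BgB → Set (Op × Hist)} {W : Set (ℕ → ℝ)}
    {A : ℕ → (ℕ → ℝ) → C.BgB → C.Dom → InnerLabel C.Dom Bnd → ℝ} {κ G' : ℝ} (hbox : BoxInClass M K W)
    (hA0 : ∀ k g U Z ℓ, 0 ≤ A k g U Z ℓ)
    (hA : ∀ k, ∀ g ∈ W, ∀ (U : C.BgB) (q : Op × Hist), q ∈ K k g U → ∀ X : C.Dom, C.scale X = k →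
      ∀ i : TermIdx C.Dom Bnd, (labelsIndexing G D).Rel k i X →
        ∀ m, ‖act ((labelsIndexing G D).poly i m) ((labelsIndexing G D).lab i m) q.1 q.2‖ ≤
          A k g U ((labelsIndexing G D).poly i m) ((labelsIndexing G D).lab i m))
    (hbud : ∀ k, ∀ g ∈ W, ∀ (U : C.BgB) (X : C.Dom), C.scale X = k →
      Summable (levelMajorant G D (A k g U) k X) ∧ ∑' n, levelMajorant G D (A k g U) k X n ≤ G' * Real.exp (-(κ * C.d X)))
    (hexp : ActExpLinearOn (labelsIndexing G D) act Dt K W) : HistFibreEnvelopeCl M W κ G' :=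
  histFibreEnvelopeCl_b13_of_actBound (labelsIndexing G D) (touchInc G) act hM hbox hA (fun k g hg U X hX =>
    ⟨summable_actMajorant_of_levelwise (hA0 k g U) hX (hbud k g hg U X hX).1,
      tsum_actMajorant_le_of_levelwise (hA0 k g U) hX (hbud k g hg U X hX).1 (hbud k g hg U X hX).2⟩) hexp

/-! ## §5 The weighted level budget DISCHARGED from leaf-08's anchored exponential activity norm (`4νΦ < 1`, rate `κ = 0`) -/

omit [NormedAddCommGroup Op] [NormedSpace ℂ Op] [NormedAddCommGroup Hist] [NormedSpace ℂ Hist] [MeasurableSpace Ω] in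
/-- [folklore] **THE WEIGHTED LEVEL BUDGET FROM THE ANCHORED NORM**: under the same data with `4νΦ < 1`, the `(n+1)`-weighted level
series converges and `Σ' n, (n+1)·levelMajorant G D A k X n ≤ Φ∕(1 − 4νΦ)²` (leaf-08's `UrsellTermBudget.levelMajorant_le` (module `UrsellTermBudgetLevels`)
BY NAME + comparison with the arithmetico-geometric series `Σ (n+1)x^n = 1∕(1−x)²`, Mathlib's
`hasSum_choose_mul_geometric_of_norm_lt_one 1`). -/
theorem weighted_level_budget_of_actNorm {A : C.Dom → InnerLabel C.Dom Bnd → ℝ} (reach : C.Dom → Finset Cube) {ν Φ : ℝ}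
    (hA : ∀ Z ℓ, 0 ≤ A Z ℓ) (hloc : ∀ Z Z', touchInc G Z' Z → ∃ q ∈ reach Z, q ∈ G.cubes Z') (hν : 0 ≤ ν)
    (hreach : ∀ Z, ((reach Z).card : ℝ) ≤ ν * (G.cubes Z).card) (hΦ0 : 0 ≤ Φ) (hsmall : 4 * ν * Φ < 1) {k : ℕ}
    (hΦ : ∀ q : Cube, ∑ Z ∈ G.level k, ind (q ∈ G.cubes Z) * polyWeight D A k Z * Real.exp ((G.cubes Z).card) ≤ Φ)
    {X : C.Dom} (hX : C.scale X = k) :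
    Summable (fun n : ℕ => ((n : ℝ) + 1) * levelMajorant G D A k X n) ∧
      ∑' n : ℕ, ((n : ℝ) + 1) * levelMajorant G D A k X n ≤ Φ / (1 - 4 * ν * Φ) ^ 2 := by
  set x : ℝ := 4 * ν * Φ with hxdef
  have hx0 : 0 ≤ x := by positivity
  have hx : ‖x‖ < 1 := by rwa [Real.norm_of_nonneg hx0]
  have hgeo : HasSum (fun n : ℕ => ((n : ℝ) + 1) * x ^ n) (1 / (1 - x) ^ 2) := by
    have h := hasSum_choose_mul_geometric_of_norm_lt_one 1 hx
    refine h.congr_fun fun n => ?_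
    rw [Nat.choose_one_right]; push_cast; ring
  have hle : ∀ n : ℕ, ((n : ℝ) + 1) * levelMajorant G D A k X n ≤ Φ * (((n : ℝ) + 1) * x ^ n) := fun n =>
    calc ((n : ℝ) + 1) * levelMajorant G D A k X n ≤ ((n : ℝ) + 1) * UrsellSeriesBound.levelMajorant ν Φ n :=
          mul_le_mul_of_nonneg_left (UrsellTermBudget.levelMajorant_le G D A reach hA hloc hν hreach hΦ0 hΦ hX n)
            (by positivity)
      _ = Φ * (((n : ℝ) + 1) * x ^ n) := by rw [UrsellSeriesBound.levelMajorant]; ring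
  have hnn : ∀ n : ℕ, 0 ≤ ((n : ℝ) + 1) * levelMajorant G D A k X n :=
    fun n => mul_nonneg (by positivity) (levelMajorant_nonneg hA k X n)
  have hsF : Summable (fun n : ℕ => Φ * (((n : ℝ) + 1) * x ^ n)) := hgeo.summable.mul_left Φ
  have hs : Summable (fun n : ℕ => ((n : ℝ) + 1) * levelMajorant G D A k X n) := Summable.of_nonneg_of_le hnn hle hsF
  refine ⟨hs, ?_⟩
  calc ∑' n : ℕ, ((n : ℝ) + 1) * levelMajorant G D A k X n ≤ ∑' n : ℕ, Φ * (((n : ℝ) + 1) * x ^ n) :=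
        hs.tsum_le_tsum hle hsF
    _ = Φ * (1 / (1 - x) ^ 2) := by rw [tsum_mul_left, hgeo.tsum_eq]
    _ = Φ / (1 - x) ^ 2 := by ring

/-- [folklore] **`HistSecant` ON THE SOCKET FROM PER-ACTIVITY DATA ALONE (decay rate 0)** — the secant twin of leaf-08's
`UrsellTermBudget.classBound_b13_of_actNorm`: for a step model with `M.Out = out (labelsIndexing G D) (touchInc G) act`, leaf-08's
STRUCTURE `ActExpLinearOn`, per-activity exponent bounds `ActExpNormBound … M.rHist N` with `0 ≤ N ≤ N̄`, `0 ≤ N̄` ((2.18)∕(2.20) KIND;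
displayed), ABSOLUTE activity majorants `ActAbsBound … A` with `A ≥ 0` ((2.15)∕(2.38) KIND; displayed) whose activity sums have
anchored exponential norm `Φ` on every step catalogue with a footprint-local reach of size `ν` and `4νΦ < 1` ((2.38)+(1.26) KIND;
displayed — leaf-08's binder (i)) ⟹ `HistSecant M K W 0 (2·(N̄·Φ∕(1 − 4νΦ)²))`.  No reach, no slack, no room, no analyticity, no
series binder left: §3 with the weighted level budget of `weighted_level_budget_of_actNorm`.  (The rate `κ > 0` of (2.41) p. 21 is the
displayed geometric step (2.27), as in leaf-08's file; not here.) -/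
theorem histSecant_socket_of_actNorm {M : StepModel C Op Hist}
    (hM : ∀ k o h X, M.Out k o h X = out (labelsIndexing G D) (touchInc G) act k o h X)
    {K : ℕ → (ℕ → ℝ) → C.BgB → Set (Op × Hist)} {W : Set (ℕ → ℝ)}
    {N A : ℕ → (ℕ → ℝ) → C.BgB → C.Dom → InnerLabel C.Dom Bnd → ℝ} {Nbar ν Φ : ℝ}
    (hexp : ActExpLinearOn (labelsIndexing G D) act Dt K W) (hN : ActExpNormBound (labelsIndexing G D) Dt K W M.rHist N)
    (hN0 : ∀ k g U Z ℓ, 0 ≤ N k g U Z ℓ) (hNle : ∀ k g U Z ℓ, N k g U Z ℓ ≤ Nbar) (hNbar : 0 ≤ Nbar)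
    (habs : ActAbsBound (labelsIndexing G D) Dt K W A) (hA0 : ∀ k g U Z ℓ, 0 ≤ A k g U Z ℓ) (reach : C.Dom → Finset Cube)
    (hloc : ∀ Z Z', touchInc G Z' Z → ∃ q ∈ reach Z, q ∈ G.cubes Z') (hν : 0 ≤ ν)
    (hreach : ∀ Z, ((reach Z).card : ℝ) ≤ ν * (G.cubes Z).card) (hΦ0 : 0 ≤ Φ) (hsmall : 4 * ν * Φ < 1)
    (hΦ : ∀ k, ∀ g ∈ W, ∀ (U : C.BgB) (q : Cube),
      ∑ Z ∈ G.level k, ind (q ∈ G.cubes Z) * polyWeight D (A k g U) k Z * Real.exp ((G.cubes Z).card) ≤ Φ) :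
    HistSecant M K W 0 (2 * (Nbar * (Φ / (1 - 4 * ν * Φ) ^ 2))) :=
  histSecant_socket_of_levelMoment hM hexp hN hN0 hNle hNbar habs hA0 fun k g hg U X hX =>
    ⟨(weighted_level_budget_of_actNorm reach (hA0 k g U) hloc hν hreach hΦ0 hsmall (hΦ k g hg U) hX).1, by
      rw [zero_mul, neg_zero, Real.exp_zero, mul_one]
      exact (weighted_level_budget_of_actNorm reach (hA0 k g U) hloc hν hreach hΦ0 hsmall (hΦ k g hg U) hX).2⟩

end Payoff

end Summit.QuantumFields.BalabanUV.T4Continuum.B13TermHistSecantLevels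

end
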